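import Mathlib
import Literature.Geometry.Lorentzian.FinalEraPackage
import HarnessLib

/-!
# The final-era package of a Cauchy development, revision 2 (hypothesis structure)

The rev-2 companion of `Literature.Geometry.Lorentzian.FinalEraPackage` (`FinalEraPackage.lean`,
built for the rev-1, 29-clause package of the route `DissipativeFinalMotions` on the summit
`FinalStateConjecture`). Rev 2 of that route restated the common hypothesis of its three
package-bearing items (`FinalEraGeneric` under `∃`, `RadiativeLyapunovBudget` and
`DispersingCapture` under `∀`) as a **31-clause** package over the SAME 18 binders
`N M a T δ V C₁ C₂ ρ₀ κ ξ β U₀ B₀ B Ψ₀ Ψ O`: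

* clauses (O), (B), (B), (P)×8, (W1)–(W4), (F1)–(F3), (H1), (H3), (X1)–(X4), (EX) are token for
  token those of `FinalEraPackage`;
* (H2) — `C⁰` closeness `≤ 1/100` of the near zones `{rᵢ ≤ 2ρ₀}` on the hole slabs `{t*ᵢ = τ}`,
  `τ ≥ T` — is REPLACED by the **scale-covariant near-zone pin (H2′)**: for `m ≤ 2` the order-`m`
  coordinate derivative of the deviation `Ψᵢ^* g − g_{Mᵢ,aᵢ}` at every point of the certified
  tube `{x⁰ ≥ T, rᵢ ≤ 2ρ₀}` has norm `≤ 1/(100·Mᵢ^m)` (the tolerance in the label's own mass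
  unit, so that the curvature is pinned to Kerr `(Mᵢ, aᵢ)`'s at the `1 %` level near `r₊` and a
  chart into a nearly flat region cannot pose as a near zone);
* two clauses are APPENDED after (EX): **(AT) anti-twin** — the certified tubes
  `Ψᵢ({t*ᵢ > T, rᵢ ≤ 2ρ₀})` of distinct labels are pairwise disjoint (distinct labels are distinct
  holes), and **(ND) non-degenerate zones** — `r₊(Mᵢ, aᵢ) < ρ₀` (each certified zone is a shell
  reaching from the horizon past `2r₊`).

As for rev 1, **no printed formulation exists**: this is a *hypothesis structure* recording
the data and the clauses the route items consume (the late-time `N`-body picture of the final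
state conjecture, Dafermos–Luk, arXiv:1710.01722, p. 8 and Conjecture 1, with an
Einstein–Infeld–Hoffmann-type modulation law whose slack has the shape of the `1PN` bracket of
Blanchet, Living Rev. Relativ. 27 (2024), §3.2.2, eq. (339)). It was requested (ledger item
`defn-FinalEraPackage2`) because the three rev-2 items carry the 31 clauses inline at the
gate's signature-length cap; with the dictionary below they can be restated as
`∀ p : FinalEraPackage₂ 𝒟.toCauchyDevelopment, …` / `Nonempty (FinalEraPackage₂ …)`.
Nothing is asserted.

## Contents (namespace `Literature.Geometry.Lorentzian`)

* `CauchyDevelopment.IsFinalEra₂ 𝒟 N M a T δ V C₁ C₂ ρ₀ κ ξ β U₀ B₀ B Ψ₀ Ψ O` — the **inline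
  form**: the 31-conjunct conjunction, verbatim the hypothesis chain of the rev-2 route items
  (checked token for token against all three), with the single forced change, exactly as in
  `CauchyDevelopment.IsFinalEra`, that the summit-side auxiliary
  `Summit.FinalStateConjecture.exteriorOf 𝒟 U` is replaced by its body
  `𝒟.metric.causalFuture 𝒟.timeOrientation (range 𝒟.embed) ∩
  𝒟.metric.chronologicalPast 𝒟.timeOrientation U` (definitionally equal; `Iff.rfl` closes the
  comparison on the summit side).
* `CauchyDevelopment.IsFinalEra₂.isFinalEra` — rev 2 implies rev 1 on the same binders: (H2′) at
  `m = 0` gives (H2) (the hole backgrounds are `Kerr.background (Mᵢ, aᵢ)`, whose time function is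
  `x⁰`, so the slab `{t*ᵢ = τ}`, `τ ≥ T`, lies in `{x⁰ ≥ T}`; and
  `‖D⁰F(x)‖ ≤ 1/(100·Mᵢ⁰) = 1/100`), (AT), (ND) are dropped.
* `FinalEraPackage₂ 𝒟` — the **bundled form**: a structure with the 18 data fields and the 31
  clauses as named `Prop` fields (the 28 shared fields keep their rev-1 names; the new ones are
  `norm_iteratedFDeriv_le` (H2′), `pairwise_disjoint` (AT), `rPlus_lt` (ND)).
* the dictionary, parallel to rev 1: `FinalEraPackage₂.isFinalEra₂` (bundled ⇒ inline),
  `FinalEraPackage₂.ofIsFinalEra₂` (inline ⇒ bundled; data projections reduce by `rfl`),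
  `ofIsFinalEra₂_isFinalEra₂` (round trip, `rfl`), `nonempty_iff` (for the `∃`-item),
  `forall_iff` / `exists_iff` (for the `∀`-items), `forall_iff_forall_ofIsFinalEra₂`.
* the forgetful map `FinalEraPackage₂.toFinalEraPackage : FinalEraPackage₂ 𝒟 → FinalEraPackage 𝒟`
  (same data, by `rfl`: `toFinalEraPackage_ξ` etc.), with `FinalEraPackage₂.isFinalEra` and the
  derived rev-1 clause `FinalEraPackage₂.truncDeviationCk_le` (H2), so that everything proved
  about rev-1 packages applies to rev-2 packages.

## Design choices

Those of `FinalEraPackage` (carrier `CauchyDevelopment D`; verbatim field types; the background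
EQUATIONS kept as fields so that provers `subst` them; nothing asserted). The file is new and
append-only; `FinalEraPackage.lean` is untouched and remains the rev-1 interface.

## Mathlib

No Lorentzian geometry in Mathlib (see `KerrConvergence`); used here: `iteratedFDeriv`,
`Pairwise`, `Disjoint`, `Function.onFun`, `ENNReal.ofReal`, `ofReal_norm`. Nothing
duplicates Mathlib or the tree (`lean search --decl 'FinalEra|IsFinalEra|EraPackage'`: the rev-1
file and the route items only).

## References

* M. Dafermos, J. Luk, *The interior of dynamical vacuum black holes I*, arXiv:1710.01722,
  p. 8 and Conjecture 1 (final state conjecture).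
* A. Einstein, L. Infeld, B. Hoffmann, Ann. of Math. 39 (1938), 65–100.
* L. Blanchet, *Post-Newtonian theory for gravitational waves*, Living Rev. Relativ. 27 (2024)
  4, §3.2.2, eq. (339).
* B. O'Neill, *The geometry of Kerr black holes* (1995), Ch. 2, §2.3 (`r₊ = M + √(M² − a²)`; via
  `KerrSchild`).
* M. Dafermos, G. Holzegel, I. Rodnianski, M. Taylor, arXiv:2104.08222, §1 (late-time charts,
  near zones; via `KerrConvergence`).
-/

noncomputable section

open Set TopologicalSpace Filter MeasureTheory
open scoped Manifold ContDiff Topology ENNReal Function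

universe u

namespace Literature.Geometry.Lorentzian

variable {X : Type u} [TopologicalSpace X] [ChartedSpace E3 X] [IsManifold (𝓡 3) ∞ X]
  [ConnectedSpace X] {D : InitialDataSet (𝓡 3) X}

/-! ### The inline form -/

/-- **The tuple `(N, M, a, T, δ, V, C₁, C₂, ρ₀, κ, ξ, β, U₀, B₀, B, Ψ₀, Ψ, O)` is a rev-2 final era
of the Cauchy development `𝒟`** — the INLINE form of `FinalEraPackage₂ 𝒟`: the conjunction of
its 31 clauses (O), (B), (B), (P)×8, (W1)–(W4), (F1)–(F3), (H1), (H2′), (H3), (X1)–(X4), (EX),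
(AT), (ND), verbatim the common hypothesis chain of the rev-2 items `FinalEraGeneric` /
`RadiativeLyapunovBudget` / `DispersingCapture` of the route `DissipativeFinalMotions` (summit
`FinalStateConjecture`), except that the summit-side auxiliary
`Summit.FinalStateConjecture.exteriorOf 𝒟 U` is replaced by its body `J⁺(ι X) ∩ I⁻(U)`
(definitionally equal). It differs from the rev-1 form `CauchyDevelopment.IsFinalEra` exactly in
clause 22 ((H2) replaced by the scale-covariant pin (H2′): order-`m` derivatives of the
deviation `≤ 1/(100·Mᵢ^m)` on `{x⁰ ≥ T, rᵢ ≤ 2ρ₀}`, `m ≤ 2`) and in the two appended clauses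
(AT) pairwise disjointness of the certified tubes `Ψᵢ({t*ᵢ > T, rᵢ ≤ 2ρ₀})` and (ND)
`r₊(Mᵢ, aᵢ) < ρ₀`. See
`FinalEraPackage₂` for the meaning of each clause and `FinalEraPackage₂.nonempty_iff` /
`forall_iff` / `exists_iff` for the dictionary. No printed formulation exists (hypothesis
predicate; final state picture of Dafermos–Luk, arXiv:1710.01722, p. 8, with an
Einstein–Infeld–Hoffmann-type modulation law, Blanchet 2024, §3.2.2, eq. (339)).
[cite: DafermosLuk2017, p. 8 and Conjecture 1] [cite: Blanchet2024, §3.2.2, eq. (339)] -/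
def CauchyDevelopment.IsFinalEra₂ (𝒟 : CauchyDevelopment D) (N : ℕ) (M a : Fin N → ℝ)
    (T δ V C₁ C₂ ρ₀ κ : ℝ) (ξ : Fin N → ℝ → E3) (β : ℝ → ℝ) (U₀ : Opens E4)
    (B₀ : ModelBackground) (B : Fin N → ModelBackground) (Ψ₀ : B₀.domain → 𝒟.carrier)
    (Ψ : (i : Fin N) → (B i).domain → 𝒟.carrier) (O : Set 𝒟.carrier) : Prop :=
  O = 𝒟.metric.causalFuture 𝒟.timeOrientation (range 𝒟.embed) ∩
    𝒟.metric.chronologicalPast 𝒟.timeOrientation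
      (Ψ₀ '' B₀.lateRegion T ∪ ⋃ i, Ψ i '' (B i).lateRegion T) ∧
  B₀ = Minkowski.backgroundOn U₀ ∧ (B = fun i ↦ Kerr.background (M i) (a i)) ∧
  (∀ i, Kerr.IsSubextremal (M i) (a i)) ∧ 0 < δ ∧ 0 ≤ V ∧ V < 1 ∧ 0 ≤ C₁ ∧ 1 ≤ C₂ ∧ 0 < ρ₀ ∧
  0 ≤ κ ∧ (∀ i, ContDiff ℝ 2 (ξ i)) ∧ (∀ t, T ≤ t → ∀ i j, i ≠ j → δ ≤ ‖ξ i t - ξ j t‖) ∧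
  (∀ i s t, T ≤ s → s ≤ t → ‖ξ i t - ξ i s‖ ≤ V * (t - s)) ∧ IntegrableOn β (Ici T) ∧
  (∀ t, T ≤ t → 0 ≤ β t) ∧
  (∀ t, T ≤ t → ∀ i, ‖deriv (deriv (ξ i)) t +
      ∑ j ∈ Finset.univ.erase i, (M j / ‖ξ i t - ξ j t‖ ^ 3) • (ξ i t - ξ j t)‖ ≤
    κ * (∑ j ∈ Finset.univ.erase i, M j / ‖ξ i t - ξ j t‖ ^ 2 *
      (‖deriv (ξ i) t‖ ^ 2 + ‖deriv (ξ j) t‖ ^ 2 + (∑ l, M l) / ‖ξ i t - ξ j t‖)) + β t) ∧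
  𝒟.toSpacetime.IsLateChart B₀ O T Ψ₀ ∧
  {y : E4 | T < y 0 ∧ ∀ i, ρ₀ < ‖E4.spatial y - ξ i (y 0)‖} ⊆ (B₀.domain : Set E4) ∧
  (∀ ε : ℝ, 0 < ε → ∃ ϱ T' : ℝ, ∀ τ, T' ≤ τ →
    supCkENorm (Subtype.val '' {y : B₀.domain | y.1 0 = τ ∧ ∀ i, ϱ ≤ ‖E4.spatial y.1 - ξ i τ‖})
      2 (𝒟.toSpacetime.deviationExtend B₀ Ψ₀) ≤ ENNReal.ofReal ε) ∧
  (∀ i, 𝒟.toSpacetime.IsLateChart (B i) O T (Ψ i)) ∧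
  (∀ i (m : ℕ) (x : (B i).domain), m ≤ 2 → T ≤ x.1 0 → (B i).radius x.1 ≤ 2 * ρ₀ →
    ‖iteratedFDeriv ℝ m (𝒟.toSpacetime.deviationExtend (B i) (Ψ i)) x.1‖ ≤
      1 / (100 * M i ^ m)) ∧
  (∀ i (R ε : ℝ), 0 < ε → ∃ D' : ℝ, ∀ T' : ℝ,
    (∀ t, T' ≤ t → ∀ j, j ≠ i → D' ≤ ‖ξ i t - ξ j t‖) → ∃ T'' : ℝ, ∀ τ, T'' ≤ τ →
      𝒟.toSpacetime.truncDeviationCk (B i) (Ψ i) 2 R τ ≤ ENNReal.ofReal ε) ∧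
  (∀ i j, i ≠ j → Ψ i '' (B i).lateRegion T ∩ Ψ j '' (B j).lateRegion T ⊆ range Ψ₀) ∧
  (∀ i (x : (B i).domain) (y : B₀.domain), T < x.1 0 → Ψ i x = Ψ₀ y →
    ‖E4.spatial y.1 - ξ i (y.1 0)‖ ≤ C₂ * (B i).radius x.1 + C₁) ∧
  (∀ i (R : ℝ), ∃ T₃ : ℝ, ∀ y : B₀.domain, T₃ < y.1 0 → ‖E4.spatial y.1 - ξ i (y.1 0)‖ ≤ R →
    ∃ x : (B i).domain, Ψ i x = Ψ₀ y ∧ T < x.1 0 ∧ (B i).radius x.1 ≤ C₂ * R + C₁) ∧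
  (∀ i (t₀ : ℝ), ∃ τ' : ℝ,
    Ψ i '' (B i).lateRegion τ' ∩ Ψ₀ '' {y : B₀.domain | y.1 0 ≤ t₀} = ∅) ∧
  (∀ i (τ' R : ℝ), ∃ t₀ : ℝ, Ψ₀ '' {y : B₀.domain | t₀ < y.1 0} ∩
    Ψ i '' {x : (B i).domain | x.1 0 ≤ τ' ∧ (B i).radius x.1 ≤ R} = ∅) ∧
  (∀ τ₁, T < τ₁ →
    O \ (Ψ₀ '' B₀.lateRegion τ₁ ∪ ⋃ i, Ψ i '' (B i).truncLateRegion τ₁ (2 * ρ₀)) ⊆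
      𝒟.toSpacetime.metric.causalPast 𝒟.toSpacetime.timeOrientation
        (Ψ₀ '' B₀.timeSlab τ₁ ∪ ⋃ i, Ψ i '' (B i).truncTimeSlab (2 * ρ₀) τ₁)) ∧
  Pairwise (Disjoint on fun i ↦ Ψ i '' (B i).truncLateRegion T (2 * ρ₀)) ∧
  (∀ i, Kerr.rPlus (M i) (a i) < ρ₀)

/-- A `C⁰` sup-norm bound from a pointwise bound: if `‖D⁰f(x)‖ ≤ c` at every point of `S`, then
`supCkENorm S 0 f ≤ c` (unfolding of the `k = 0` case of the `Cᵏ` sup norm, Bartnik, CPAM 39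
(1986), (1.3); `‖·‖ₑ = ENNReal.ofReal ‖·‖`, Mathlib's `ofReal_norm`). [cite: Bartnik1986, (1.3)] -/
theorem supCkENorm_zero_le_ofReal {F G : Type*} [NormedAddCommGroup F] [NormedSpace ℝ F]
    [NormedAddCommGroup G] [NormedSpace ℝ G] {S : Set F} {f : F → G} {c : ℝ}
    (h : ∀ x ∈ S, ‖iteratedFDeriv ℝ 0 f x‖ ≤ c) : supCkENorm S 0 f ≤ ENNReal.ofReal c := by
  refine iSup₂_le fun m hm ↦ iSup₂_le fun x hx ↦ ?_
  obtain rfl : m = 0 := Nat.le_zero.mp hm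
  rw [← ofReal_norm]
  exact ENNReal.ofReal_le_ofReal (h x hx)

/-- **Rev 2 implies rev 1 on the same binders**: a tuple satisfying the 31-clause rev-2 inline
form `IsFinalEra₂` satisfies the 29-clause rev-1 inline form `IsFinalEra`. The 28 shared
clauses are passed through; (H2) — `truncDeviationCk (B i) (Ψ i) 0 (2ρ₀) τ ≤ 1/100` for
`τ ≥ T` — follows from (H2′) at `m = 0`: the hole background is `Kerr.background (Mᵢ, aᵢ)`
(clause (B)), whose time function is the coordinate `x⁰`, so a point of the truncated slab
`{t*ᵢ = τ, rᵢ ≤ 2ρ₀}` has `x⁰ = τ ≥ T`, and there `‖D⁰(Ψᵢ^* g − g_{Mᵢ,aᵢ})(x)‖ ≤ 1/(100·Mᵢ⁰) =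
1/100`; (AT) and (ND) are dropped. Dafermos–Luk, arXiv:1710.01722, p. 8 (the picture; no
printed formulation). [cite: DafermosLuk2017, p. 8] -/
theorem CauchyDevelopment.IsFinalEra₂.isFinalEra {𝒟 : CauchyDevelopment D} {N : ℕ}
    {M a : Fin N → ℝ} {T δ V C₁ C₂ ρ₀ κ : ℝ} {ξ : Fin N → ℝ → E3} {β : ℝ → ℝ} {U₀ : Opens E4}
    {B₀ : ModelBackground} {B : Fin N → ModelBackground} {Ψ₀ : B₀.domain → 𝒟.carrier}
    {Ψ : (i : Fin N) → (B i).domain → 𝒟.carrier} {O : Set 𝒟.carrier}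
    (h : 𝒟.IsFinalEra₂ N M a T δ V C₁ C₂ ρ₀ κ ξ β U₀ B₀ B Ψ₀ Ψ O) :
    𝒟.IsFinalEra N M a T δ V C₁ C₂ ρ₀ κ ξ β U₀ B₀ B Ψ₀ Ψ O := by
  obtain ⟨h₁, h₂, h₃, h₄, h₅, h₆, h₇, h₈, h₉, h₁₀, h₁₁, h₁₂, h₁₃, h₁₄, h₁₅, h₁₆, h₁₇, h₁₈, h₁₉,
    h₂₀, h₂₁, h₂₂, h₂₃, h₂₄, h₂₅, h₂₆, h₂₇, h₂₈, h₂₉, -, -⟩ := h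
  refine ⟨h₁, h₂, h₃, h₄, h₅, h₆, h₇, h₈, h₉, h₁₀, h₁₁, h₁₂, h₁₃, h₁₄, h₁₅, h₁₆, h₁₇, h₁₈, h₁₉,
    h₂₀, h₂₁, fun i τ hτ ↦ ?_, h₂₃, h₂₄, h₂₅, h₂₆, h₂₇, h₂₈, h₂₉⟩
  subst h₃
  refine supCkENorm_zero_le_ofReal fun y hy ↦ ?_
  obtain ⟨x, hx, rfl⟩ := hy
  have hx₀ : x.1 0 = τ := hx.1
  have := h₂₂ i 0 x (Nat.zero_le 2) (hτ.trans_eq hx₀.symm) hx.2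
  rwa [pow_zero, mul_one] at this

/-! ### The bundled form -/

/-- **Hypothesis structure: a rev-2 final-era package** of the Cauchy development `𝒟` of
`3`-dimensional initial data — the late-time `N`-body picture of the final state conjecture
("settle down to finitely many rotating Kerr black holes moving away from each other",
Dafermos–Luk, arXiv:1710.01722, p. 8; Penrose 1982, Problem 12) in consequence form over the
vocabulary of `KerrConvergence`, in the 31-clause revision of the route `DissipativeFinalMotions`
(summit `FinalStateConjecture`). DATA (the 18 binders of the route items, same names as in
`FinalEraPackage`): `N`; Kerr labels `M a : Fin N → ℝ`; a late time `T`; constants `δ`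
(separation floor), `V` (speed bound), `C₁, C₂` (chart localisation), `ρ₀` (near-zone radius),
`κ` (post-Newtonian slack); worldlines `ξ : Fin N → ℝ → E3` in the flat chart; a slack function
`β`; the flat domain `U₀`; backgrounds `B₀` (flat) and `B` (holes); chart maps `Ψ₀`, `Ψ i`; the
region `O`. CLAUSES (31 `Prop` fields, verbatim the rev-2 conjuncts): (O) `O` is the
self-determined exterior `J⁺(ι X) ∩ I⁻(Ψ₀(late T) ∪ ⋃ᵢ Ψᵢ(late T))`; (B) `B₀` is Minkowski on `U₀`
and `B i` is rest-frame Kerr–Schild `(Mᵢ, aᵢ)` (equations); (P) sub-extremal labels and the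
signs/ranges of the constants; (W1)–(W4) `C²` worldlines, `δ`-separation after `T`, `V`-Lipschitz
on `[T, ∞)`, and the near-Newtonian modulation law
`‖ξ̈ᵢ + Σ_{j≠i} Mⱼ(ξᵢ − ξⱼ)/‖ξᵢ − ξⱼ‖³‖ ≤ κ Σ_{j≠i} (Mⱼ/dᵢⱼ²)(‖ξ̇ᵢ‖² + ‖ξ̇ⱼ‖² + (Σₗ Mₗ)/dᵢⱼ) + β t`
with `β ≥ 0` integrable on `[T, ∞)` (Einstein–Infeld–Hoffmann 1938; the slack has the shape of
the `1PN` bracket of Blanchet 2024, eq. (339)); (F1)–(F3) `Ψ₀` is a late chart into `O`, its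
domain contains `{t > T}` minus the `ρ₀`-tubes about the `ξᵢ`, and `Ψ₀^* g → η` in `C²` beyond
flat distance `ϱ(ε)` from all holes; (H1) each `Ψᵢ` is a late chart into `O`; **(H2′, rev 2)**
the SCALE-COVARIANT near-zone pin: for `m ≤ 2`, at every point of the hole chart with `x⁰ ≥ T`
and `rᵢ ≤ 2ρ₀`, `‖D^m(Ψᵢ^* g − g_{Mᵢ,aᵢ})(x)‖ ≤ 1/(100·Mᵢ^m)` (`C⁰` tolerance `1/100` as in
rev 1, `C¹` and `C²` in the label's own mass unit); (H3) effacement: an eventually isolated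
hole converges in `C²` on every `{rᵢ ≤ R}`; (X1)–(X4) hole charts overlap only inside
`range Ψ₀`, two-sided chart localisation `|x̲ − ξᵢ(t)| ≤ C₂ rᵢ + C₁` and conversely, and
qualitative comparison of the hole clocks with the flat clock; (EX) for every chart time
`τ₁ > T` the flat late region and the certified zones exhaust `O` up to the causal past of the
certified slab at `τ₁`; **(AT, rev 2)** anti-twin: the certified tubes
`Ψᵢ({t*ᵢ > T, rᵢ ≤ 2ρ₀})` are pairwise disjoint; **(ND, rev 2)** non-degenerate zones:
`r₊(Mᵢ, aᵢ) < ρ₀`. **No printed formulation exists** (cf. `FinalEraPackage`,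
`FinalStateDecomposition`); the rev-2 items restate over it via `nonempty_iff` / `forall_iff`,
and `toFinalEraPackage` forgets to the rev-1 package.
[cite: DafermosLuk2017, p. 8 and Conjecture 1]
[cite: Blanchet2024, §1 (item 1: Einstein et al. 1938) and §3.2.2, eq. (339)] -/
structure FinalEraPackage₂ (𝒟 : CauchyDevelopment D) where
  /-- The number `N` of final black holes. -/
  N : ℕ
  /-- The Kerr masses `Mᵢ` of the holes. -/
  M : Fin N → ℝ
  /-- The Kerr specific angular momenta `aᵢ` of the holes. -/
  a : Fin N → ℝ
  /-- The late time `T` after which the era is in force. -/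
  T : ℝ
  /-- The separation floor `δ`. -/
  δ : ℝ
  /-- The speed (Lipschitz) bound `V` of the worldlines. -/
  V : ℝ
  /-- The additive chart-localisation constant `C₁`. -/
  C₁ : ℝ
  /-- The multiplicative chart-localisation constant `C₂`. -/
  C₂ : ℝ
  /-- The near-zone radius `ρ₀` (certified zones are `{rᵢ ≤ 2ρ₀}`). -/
  ρ₀ : ℝ
  /-- The post-Newtonian slack constant `κ` of the modulation law. -/
  κ : ℝ
  /-- The worldlines `ξᵢ : ℝ → ℝ³` of the holes in the flat chart (flat time parameter). -/
  ξ : Fin N → ℝ → E3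
  /-- The integrable slack `β(t)` of the modulation law. -/
  β : ℝ → ℝ
  /-- The coordinate domain `U₀ ⊆ E4` of the flat chart. -/
  U₀ : Opens E4
  /-- The flat reference background (pinned to `Minkowski.backgroundOn U₀` by `B₀_eq`). -/
  B₀ : ModelBackground
  /-- The hole reference backgrounds (pinned to `Kerr.background (M i) (a i)` by `B_eq`). -/
  B : Fin N → ModelBackground
  /-- The flat (radiation-zone) chart map. -/
  Ψ₀ : B₀.domain → 𝒟.carrier
  /-- The near-zone chart map of hole `i`. -/
  Ψ : (i : Fin N) → (B i).domain → 𝒟.carrier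
  /-- The exterior region carrying the charts. -/
  O : Set 𝒟.carrier
  /-- (O) The region `O` IS the self-determined exterior `J⁺(ι X) ∩ I⁻(charted late sets)`:
  verbatim the body of `Summit.FinalStateConjecture.exteriorOf` / `Development.exteriorOf` at
  `U = Ψ₀(late T) ∪ ⋃ᵢ Ψᵢ(late T)`. -/
  O_eq :
    O = 𝒟.metric.causalFuture 𝒟.timeOrientation (range 𝒟.embed) ∩
      𝒟.metric.chronologicalPast 𝒟.timeOrientation
        (Ψ₀ '' B₀.lateRegion T ∪ ⋃ i, Ψ i '' (B i).lateRegion T)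
  /-- (B) The flat background is Minkowski on `U₀` (an equation, so that users may `subst`). -/
  B₀_eq : B₀ = Minkowski.backgroundOn U₀
  /-- (B) The hole backgrounds are the rest-frame Kerr–Schild backgrounds of the labels
  `(Mᵢ, aᵢ)` (an equation, so that users may `subst`). -/
  B_eq : B = fun i ↦ Kerr.background (M i) (a i)
  /-- (P) Every label is sub-extremal, `|aᵢ| < Mᵢ`. -/
  isSubextremal : ∀ i, Kerr.IsSubextremal (M i) (a i)
  /-- (P) The separation floor is positive. -/
  δ_pos : 0 < δ
  /-- (P) The speed bound is non-negative. -/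
  V_nonneg : 0 ≤ V
  /-- (P) The speed bound is subluminal, `V < 1`. -/
  V_lt_one : V < 1
  /-- (P) The additive localisation constant is non-negative. -/
  C₁_nonneg : 0 ≤ C₁
  /-- (P) The multiplicative localisation constant is at least `1`. -/
  one_le_C₂ : 1 ≤ C₂
  /-- (P) The near-zone radius is positive. -/
  ρ₀_pos : 0 < ρ₀
  /-- (P) The post-Newtonian slack constant is non-negative. -/
  κ_nonneg : 0 ≤ κ
  /-- (W1) The worldlines are `C²`. -/
  contDiff_ξ : ∀ i, ContDiff ℝ 2 (ξ i)
  /-- (W2) Separation floor: distinct holes stay `δ`-apart after time `T`. -/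
  le_norm_sub : ∀ t, T ≤ t → ∀ i j, i ≠ j → δ ≤ ‖ξ i t - ξ j t‖
  /-- (W3) The worldlines are `V`-Lipschitz on `[T, ∞)`. -/
  norm_sub_le : ∀ i s t, T ≤ s → s ≤ t → ‖ξ i t - ξ i s‖ ≤ V * (t - s)
  /-- (W4) The slack `β` is integrable on `[T, ∞)`. -/
  integrableOn_β : IntegrableOn β (Ici T)
  /-- (W4) The slack `β` is non-negative on `[T, ∞)`. -/
  β_nonneg : ∀ t, T ≤ t → 0 ≤ β t
  /-- (W4) The near-Newtonian MODULATION LAW with post-Newtonian-type slack, for `t ≥ T`: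
  `‖ξ̈ᵢ + Σ_{j≠i} Mⱼ(ξᵢ − ξⱼ)/dᵢⱼ³‖ ≤ κ Σ_{j≠i} (Mⱼ/dᵢⱼ²)(‖ξ̇ᵢ‖² + ‖ξ̇ⱼ‖² + (Σₗ Mₗ)/dᵢⱼ) + β t`,
  `dᵢⱼ = ‖ξᵢ(t) − ξⱼ(t)‖` (Einstein–Infeld–Hoffmann 1938; Blanchet 2024, §3.2.2, eq. (339)). -/
  modulation : ∀ t, T ≤ t → ∀ i, ‖deriv (deriv (ξ i)) t +
      ∑ j ∈ Finset.univ.erase i, (M j / ‖ξ i t - ξ j t‖ ^ 3) • (ξ i t - ξ j t)‖ ≤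
    κ * (∑ j ∈ Finset.univ.erase i, M j / ‖ξ i t - ξ j t‖ ^ 2 *
      (‖deriv (ξ i) t‖ ^ 2 + ‖deriv (ξ j) t‖ ^ 2 + (∑ l, M l) / ‖ξ i t - ξ j t‖)) + β t
  /-- (F1) The flat chart `Ψ₀` is a late-time chart into `O` after `T`. -/
  isLateChart_flat : 𝒟.toSpacetime.IsLateChart B₀ O T Ψ₀
  /-- (F2) The flat domain contains every point of `{t > T}` at flat distance `> ρ₀` from all the
  `ξᵢ(t)` (the late half-space minus the closed `ρ₀`-tubes about the worldlines). -/
  setOf_subset_domain :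
    {y : E4 | T < y 0 ∧ ∀ i, ρ₀ < ‖E4.spatial y - ξ i (y 0)‖} ⊆ (B₀.domain : Set E4)
  /-- (F3) `C²` flatness of `Ψ₀` far from the holes at late times: for every `ε > 0` there are
  `ϱ, T'` such that for `τ ≥ T'` the `C²` sup norm of `Ψ₀^* g − η` over the part of the flat slab
  `{x⁰ = τ}` at flat distance `≥ ϱ` from every `ξᵢ(τ)` is `≤ ε`. -/
  supCkENorm_le : ∀ ε : ℝ, 0 < ε → ∃ ϱ T' : ℝ, ∀ τ, T' ≤ τ →
    supCkENorm (Subtype.val '' {y : B₀.domain | y.1 0 = τ ∧ ∀ i, ϱ ≤ ‖E4.spatial y.1 - ξ i τ‖})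
      2 (𝒟.toSpacetime.deviationExtend B₀ Ψ₀) ≤ ENNReal.ofReal ε
  /-- (H1) Each hole chart `Ψᵢ` is a late-time chart into `O` after `T`. -/
  isLateChart : ∀ i, 𝒟.toSpacetime.IsLateChart (B i) O T (Ψ i)
  /-- (H2′, rev 2) The SCALE-COVARIANT NEAR-ZONE PIN: for `m ≤ 2`, at every point `x` of the hole
  chart domain with `x⁰ ≥ T` and `rᵢ(x) ≤ 2ρ₀`, the order-`m` coordinate derivative of the
  deviation `Ψᵢ^* g − g_{Mᵢ,aᵢ}` (extended by zero off the domain, `deviationExtend`) has norm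
  `≤ 1/(100·Mᵢ^m)` — the `C⁰` tolerance `1/100` of rev 1, and the `C¹`, `C²` tolerances in the
  label's own mass unit. Replaces the rev-1 clause (H2), which it implies
  (`FinalEraPackage₂.truncDeviationCk_le`). -/
  norm_iteratedFDeriv_le : ∀ i (m : ℕ) (x : (B i).domain), m ≤ 2 → T ≤ x.1 0 →
    (B i).radius x.1 ≤ 2 * ρ₀ →
      ‖iteratedFDeriv ℝ m (𝒟.toSpacetime.deviationExtend (B i) (Ψ i)) x.1‖ ≤ 1 / (100 * M i ^ m)
  /-- (H3) Effacement: for all `i`, `R` and `ε > 0` there is an isolation distance `D'` such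
  that whenever hole `i` stays `D'`-far from every other hole after some `T'`, the `C²` deviation
  of `Ψᵢ^* g` from Kerr `(Mᵢ, aᵢ)` on `{rᵢ ≤ R}` is eventually `≤ ε`. -/
  effacement : ∀ i (R ε : ℝ), 0 < ε → ∃ D' : ℝ, ∀ T' : ℝ,
    (∀ t, T' ≤ t → ∀ j, j ≠ i → D' ≤ ‖ξ i t - ξ j t‖) → ∃ T'' : ℝ, ∀ τ, T'' ≤ τ →
      𝒟.toSpacetime.truncDeviationCk (B i) (Ψ i) 2 R τ ≤ ENNReal.ofReal ε
  /-- (X1) Distinct holes' late images meet only inside the flat-charted region `range Ψ₀`. -/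
  inter_subset_range :
    ∀ i j, i ≠ j → Ψ i '' (B i).lateRegion T ∩ Ψ j '' (B j).lateRegion T ⊆ range Ψ₀
  /-- (X2) Chart localisation: a point charted both by hole `i` at hole time `> T` and by the
  flat chart lies within flat distance `C₂ rᵢ + C₁` of the worldline `ξᵢ` at its flat time. -/
  localisation : ∀ i (x : (B i).domain) (y : B₀.domain), T < x.1 0 → Ψ i x = Ψ₀ y →
    ‖E4.spatial y.1 - ξ i (y.1 0)‖ ≤ C₂ * (B i).radius x.1 + C₁
  /-- (X3) Converse localisation: for every `R`, late enough flat-charted points within flat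
  distance `R` of `ξᵢ` are charted by hole `i` at hole time `> T` and radius `≤ C₂ R + C₁`. -/
  localisation_converse : ∀ i (R : ℝ), ∃ T₃ : ℝ, ∀ y : B₀.domain, T₃ < y.1 0 →
    ‖E4.spatial y.1 - ξ i (y.1 0)‖ ≤ R →
      ∃ x : (B i).domain, Ψ i x = Ψ₀ y ∧ T < x.1 0 ∧ (B i).radius x.1 ≤ C₂ * R + C₁
  /-- (X4) Clock comparison, hole to flat: late enough hole-chart regions avoid every
  bounded-time part of the flat chart. -/
  clock_hole : ∀ i (t₀ : ℝ), ∃ τ' : ℝ,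
    Ψ i '' (B i).lateRegion τ' ∩ Ψ₀ '' {y : B₀.domain | y.1 0 ≤ t₀} = ∅
  /-- (X4) Clock comparison, flat to hole: late enough flat-chart regions avoid every
  bounded-time, bounded-radius part of a hole chart. -/
  clock_flat : ∀ i (τ' R : ℝ), ∃ t₀ : ℝ, Ψ₀ '' {y : B₀.domain | t₀ < y.1 0} ∩
    Ψ i '' {x : (B i).domain | x.1 0 ≤ τ' ∧ (B i).radius x.1 ≤ R} = ∅
  /-- (EX) Exhaustion: for every chart time `τ₁ > T`, every point of `O` neither in the flat
  late region `Ψ₀({x⁰ > τ₁})` nor in a certified zone `Ψᵢ({t*ᵢ > τ₁, rᵢ ≤ 2ρ₀})` lies in the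
  causal past of the certified slab `Ψ₀({x⁰ = τ₁}) ∪ ⋃ᵢ Ψᵢ({t*ᵢ = τ₁, rᵢ ≤ 2ρ₀})`. -/
  exhaustion : ∀ τ₁, T < τ₁ →
    O \ (Ψ₀ '' B₀.lateRegion τ₁ ∪ ⋃ i, Ψ i '' (B i).truncLateRegion τ₁ (2 * ρ₀)) ⊆
      𝒟.toSpacetime.metric.causalPast 𝒟.toSpacetime.timeOrientation
        (Ψ₀ '' B₀.timeSlab τ₁ ∪ ⋃ i, Ψ i '' (B i).truncTimeSlab (2 * ρ₀) τ₁)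
  /-- (AT, rev 2) Anti-twin: the certified tubes `Ψᵢ({t*ᵢ > T, rᵢ ≤ 2ρ₀})` of distinct labels
  are pairwise disjoint (distinct labels chart distinct holes). -/
  pairwise_disjoint : Pairwise (Disjoint on fun i ↦ Ψ i '' (B i).truncLateRegion T (2 * ρ₀))
  /-- (ND, rev 2) Non-degenerate zones: the outer horizon radius `r₊(Mᵢ, aᵢ) = Mᵢ + √(Mᵢ² − aᵢ²)`
  of every label is `< ρ₀`, so the certified zone `{rᵢ ≤ 2ρ₀}` is a shell reaching from the
  horizon past `2r₊` (O'Neill 1995, Ch. 2, §2.3 for `r₊`). -/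
  rPlus_lt : ∀ i, Kerr.rPlus (M i) (a i) < ρ₀

namespace FinalEraPackage₂

variable {𝒟 : CauchyDevelopment D}

/-- Bundled ⇒ inline: the data of a rev-2 final-era package satisfy the inline predicate
`CauchyDevelopment.IsFinalEra₂` (the 31 fields, reassembled as the route's conjunction).
Dafermos–Luk, arXiv:1710.01722, p. 8 (the picture; no printed formulation).
[cite: DafermosLuk2017, p. 8] -/
theorem isFinalEra₂ (p : FinalEraPackage₂ 𝒟) :
    𝒟.IsFinalEra₂ p.N p.M p.a p.T p.δ p.V p.C₁ p.C₂ p.ρ₀ p.κ p.ξ p.β p.U₀ p.B₀ p.B p.Ψ₀ p.Ψ p.O :=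
  ⟨p.O_eq, p.B₀_eq, p.B_eq, p.isSubextremal, p.δ_pos, p.V_nonneg, p.V_lt_one, p.C₁_nonneg,
    p.one_le_C₂, p.ρ₀_pos, p.κ_nonneg, p.contDiff_ξ, p.le_norm_sub, p.norm_sub_le,
    p.integrableOn_β, p.β_nonneg, p.modulation, p.isLateChart_flat, p.setOf_subset_domain,
    p.supCkENorm_le, p.isLateChart, p.norm_iteratedFDeriv_le, p.effacement, p.inter_subset_range,
    p.localisation, p.localisation_converse, p.clock_hole, p.clock_flat, p.exhaustion,
    p.pairwise_disjoint, p.rPlus_lt⟩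

/-- Inline ⇒ bundled: a tuple satisfying `CauchyDevelopment.IsFinalEra₂` packages into a
`FinalEraPackage₂` with the same data (all data projections of `ofIsFinalEra₂ h` reduce by
`rfl`, e.g. `(ofIsFinalEra₂ h).ξ = ξ`; use `dsimp only [ofIsFinalEra₂]`). Dafermos–Luk,
arXiv:1710.01722, p. 8 (the picture; no printed formulation). [cite: DafermosLuk2017, p. 8] -/
def ofIsFinalEra₂ {N : ℕ} {M a : Fin N → ℝ} {T δ V C₁ C₂ ρ₀ κ : ℝ} {ξ : Fin N → ℝ → E3}
    {β : ℝ → ℝ} {U₀ : Opens E4} {B₀ : ModelBackground} {B : Fin N → ModelBackground}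
    {Ψ₀ : B₀.domain → 𝒟.carrier} {Ψ : (i : Fin N) → (B i).domain → 𝒟.carrier}
    {O : Set 𝒟.carrier} (h : 𝒟.IsFinalEra₂ N M a T δ V C₁ C₂ ρ₀ κ ξ β U₀ B₀ B Ψ₀ Ψ O) :
    FinalEraPackage₂ 𝒟 where
  N := N
  M := M
  a := a
  T := T
  δ := δ
  V := V
  C₁ := C₁
  C₂ := C₂
  ρ₀ := ρ₀
  κ := κ
  ξ := ξ
  β := β
  U₀ := U₀
  B₀ := B₀
  B := B
  Ψ₀ := Ψ₀
  Ψ := Ψ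
  O := O
  O_eq := h.1
  B₀_eq := h.2.1
  B_eq := h.2.2.1
  isSubextremal := h.2.2.2.1
  δ_pos := h.2.2.2.2.1
  V_nonneg := h.2.2.2.2.2.1
  V_lt_one := h.2.2.2.2.2.2.1
  C₁_nonneg := h.2.2.2.2.2.2.2.1
  one_le_C₂ := h.2.2.2.2.2.2.2.2.1
  ρ₀_pos := h.2.2.2.2.2.2.2.2.2.1
  κ_nonneg := h.2.2.2.2.2.2.2.2.2.2.1
  contDiff_ξ := h.2.2.2.2.2.2.2.2.2.2.2.1
  le_norm_sub := h.2.2.2.2.2.2.2.2.2.2.2.2.1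
  norm_sub_le := h.2.2.2.2.2.2.2.2.2.2.2.2.2.1
  integrableOn_β := h.2.2.2.2.2.2.2.2.2.2.2.2.2.2.1
  β_nonneg := h.2.2.2.2.2.2.2.2.2.2.2.2.2.2.2.1
  modulation := h.2.2.2.2.2.2.2.2.2.2.2.2.2.2.2.2.1
  isLateChart_flat := h.2.2.2.2.2.2.2.2.2.2.2.2.2.2.2.2.2.1
  setOf_subset_domain := h.2.2.2.2.2.2.2.2.2.2.2.2.2.2.2.2.2.2.1
  supCkENorm_le := h.2.2.2.2.2.2.2.2.2.2.2.2.2.2.2.2.2.2.2.1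
  isLateChart := h.2.2.2.2.2.2.2.2.2.2.2.2.2.2.2.2.2.2.2.2.1
  norm_iteratedFDeriv_le := h.2.2.2.2.2.2.2.2.2.2.2.2.2.2.2.2.2.2.2.2.2.1
  effacement := h.2.2.2.2.2.2.2.2.2.2.2.2.2.2.2.2.2.2.2.2.2.2.1
  inter_subset_range := h.2.2.2.2.2.2.2.2.2.2.2.2.2.2.2.2.2.2.2.2.2.2.2.1
  localisation := h.2.2.2.2.2.2.2.2.2.2.2.2.2.2.2.2.2.2.2.2.2.2.2.2.1
  localisation_converse := h.2.2.2.2.2.2.2.2.2.2.2.2.2.2.2.2.2.2.2.2.2.2.2.2.2.1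
  clock_hole := h.2.2.2.2.2.2.2.2.2.2.2.2.2.2.2.2.2.2.2.2.2.2.2.2.2.2.1
  clock_flat := h.2.2.2.2.2.2.2.2.2.2.2.2.2.2.2.2.2.2.2.2.2.2.2.2.2.2.2.1
  exhaustion := h.2.2.2.2.2.2.2.2.2.2.2.2.2.2.2.2.2.2.2.2.2.2.2.2.2.2.2.2.1
  pairwise_disjoint := h.2.2.2.2.2.2.2.2.2.2.2.2.2.2.2.2.2.2.2.2.2.2.2.2.2.2.2.2.2.1
  rPlus_lt := h.2.2.2.2.2.2.2.2.2.2.2.2.2.2.2.2.2.2.2.2.2.2.2.2.2.2.2.2.2.2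

/-- Round trip: re-packaging the inline form of a rev-2 package gives the package back
(structure eta and proof irrelevance, `rfl`). [folklore] -/
@[simp]
theorem ofIsFinalEra₂_isFinalEra₂ (p : FinalEraPackage₂ 𝒟) : ofIsFinalEra₂ p.isFinalEra₂ = p :=
  rfl

/-- **Dictionary for the `∃`-item** (`FinalEraGeneric`, rev 2): `𝒟` admits a rev-2 final-era
package iff some tuple of the 18 binders satisfies the inline 31-conjunct form. Dafermos–Luk,
arXiv:1710.01722, p. 8 (the picture; no printed formulation). [cite: DafermosLuk2017, p. 8] -/
theorem nonempty_iff : Nonempty (FinalEraPackage₂ 𝒟) ↔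
    ∃ (N : ℕ) (M a : Fin N → ℝ) (T δ V C₁ C₂ ρ₀ κ : ℝ) (ξ : Fin N → ℝ → E3) (β : ℝ → ℝ)
      (U₀ : Opens E4) (B₀ : ModelBackground) (B : Fin N → ModelBackground)
      (Ψ₀ : B₀.domain → 𝒟.carrier) (Ψ : (i : Fin N) → (B i).domain → 𝒟.carrier)
      (O : Set 𝒟.carrier), 𝒟.IsFinalEra₂ N M a T δ V C₁ C₂ ρ₀ κ ξ β U₀ B₀ B Ψ₀ Ψ O :=
  ⟨fun ⟨p⟩ ↦ ⟨p.N, p.M, p.a, p.T, p.δ, p.V, p.C₁, p.C₂, p.ρ₀, p.κ, p.ξ, p.β, p.U₀, p.B₀, p.B, p.Ψ₀,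
    p.Ψ, p.O, p.isFinalEra₂⟩,
    fun ⟨_, _, _, _, _, _, _, _, _, _, _, _, _, _, _, _, _, _, h⟩ ↦ ⟨ofIsFinalEra₂ h⟩⟩

/-- Quantifying a property of rev-2 packages over all packages is quantifying it over all inline
tuples, re-packaged (structure eta). [folklore] -/
theorem forall_iff_forall_ofIsFinalEra₂ {Q : FinalEraPackage₂ 𝒟 → Prop} :
    (∀ p, Q p) ↔
      ∀ (N : ℕ) (M a : Fin N → ℝ) (T δ V C₁ C₂ ρ₀ κ : ℝ) (ξ : Fin N → ℝ → E3) (β : ℝ → ℝ)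
        (U₀ : Opens E4) (B₀ : ModelBackground) (B : Fin N → ModelBackground)
        (Ψ₀ : B₀.domain → 𝒟.carrier) (Ψ : (i : Fin N) → (B i).domain → 𝒟.carrier)
        (O : Set 𝒟.carrier) (h : 𝒟.IsFinalEra₂ N M a T δ V C₁ C₂ ρ₀ κ ξ β U₀ B₀ B Ψ₀ Ψ O),
        Q (ofIsFinalEra₂ h) :=
  ⟨fun H _ _ _ _ _ _ _ _ _ _ _ _ _ _ _ _ _ _ h ↦ H (ofIsFinalEra₂ h), fun H p ↦
    H p.N p.M p.a p.T p.δ p.V p.C₁ p.C₂ p.ρ₀ p.κ p.ξ p.β p.U₀ p.B₀ p.B p.Ψ₀ p.Ψ p.O p.isFinalEra₂⟩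

/-- **Dictionary for the `∀`-items** (`RadiativeLyapunovBudget`, `DispersingCapture`, rev 2):
a conclusion `Q` about the 18 binders holds for (the data of) every rev-2 final-era package iff
it holds for every tuple of binders under the inline 31-conjunct hypothesis — the shape
`∀ N M a … O, ⟨conjuncts⟩ → Q N M a … O` of the route items. Dafermos–Luk, arXiv:1710.01722,
p. 8 (the picture; no printed formulation). [cite: DafermosLuk2017, p. 8] -/
theorem forall_iff
    {Q : ∀ (N : ℕ) (M a : Fin N → ℝ) (T δ V C₁ C₂ ρ₀ κ : ℝ) (ξ : Fin N → ℝ → E3) (β : ℝ → ℝ)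
      (U₀ : Opens E4) (B₀ : ModelBackground) (B : Fin N → ModelBackground)
      (Ψ₀ : B₀.domain → 𝒟.carrier) (Ψ : (i : Fin N) → (B i).domain → 𝒟.carrier)
      (O : Set 𝒟.carrier), Prop} :
    (∀ p : FinalEraPackage₂ 𝒟,
        Q p.N p.M p.a p.T p.δ p.V p.C₁ p.C₂ p.ρ₀ p.κ p.ξ p.β p.U₀ p.B₀ p.B p.Ψ₀ p.Ψ p.O) ↔
      ∀ (N : ℕ) (M a : Fin N → ℝ) (T δ V C₁ C₂ ρ₀ κ : ℝ) (ξ : Fin N → ℝ → E3) (β : ℝ → ℝ)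
        (U₀ : Opens E4) (B₀ : ModelBackground) (B : Fin N → ModelBackground)
        (Ψ₀ : B₀.domain → 𝒟.carrier) (Ψ : (i : Fin N) → (B i).domain → 𝒟.carrier)
        (O : Set 𝒟.carrier), 𝒟.IsFinalEra₂ N M a T δ V C₁ C₂ ρ₀ κ ξ β U₀ B₀ B Ψ₀ Ψ O →
        Q N M a T δ V C₁ C₂ ρ₀ κ ξ β U₀ B₀ B Ψ₀ Ψ O :=
  ⟨fun H _ _ _ _ _ _ _ _ _ _ _ _ _ _ _ _ _ _ h ↦ H (ofIsFinalEra₂ h), fun H p ↦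
    H p.N p.M p.a p.T p.δ p.V p.C₁ p.C₂ p.ρ₀ p.κ p.ξ p.β p.U₀ p.B₀ p.B p.Ψ₀ p.Ψ p.O p.isFinalEra₂⟩

/-- Existential companion of `forall_iff`: some rev-2 final-era package has data satisfying `Q`
iff some tuple of binders satisfies the inline form together with `Q`. Dafermos–Luk,
arXiv:1710.01722, p. 8 (the picture; no printed formulation). [cite: DafermosLuk2017, p. 8] -/
theorem exists_iff
    {Q : ∀ (N : ℕ) (M a : Fin N → ℝ) (T δ V C₁ C₂ ρ₀ κ : ℝ) (ξ : Fin N → ℝ → E3) (β : ℝ → ℝ)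
      (U₀ : Opens E4) (B₀ : ModelBackground) (B : Fin N → ModelBackground)
      (Ψ₀ : B₀.domain → 𝒟.carrier) (Ψ : (i : Fin N) → (B i).domain → 𝒟.carrier)
      (O : Set 𝒟.carrier), Prop} :
    (∃ p : FinalEraPackage₂ 𝒟,
        Q p.N p.M p.a p.T p.δ p.V p.C₁ p.C₂ p.ρ₀ p.κ p.ξ p.β p.U₀ p.B₀ p.B p.Ψ₀ p.Ψ p.O) ↔
      ∃ (N : ℕ) (M a : Fin N → ℝ) (T δ V C₁ C₂ ρ₀ κ : ℝ) (ξ : Fin N → ℝ → E3) (β : ℝ → ℝ)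
        (U₀ : Opens E4) (B₀ : ModelBackground) (B : Fin N → ModelBackground)
        (Ψ₀ : B₀.domain → 𝒟.carrier) (Ψ : (i : Fin N) → (B i).domain → 𝒟.carrier)
        (O : Set 𝒟.carrier), 𝒟.IsFinalEra₂ N M a T δ V C₁ C₂ ρ₀ κ ξ β U₀ B₀ B Ψ₀ Ψ O ∧
        Q N M a T δ V C₁ C₂ ρ₀ κ ξ β U₀ B₀ B Ψ₀ Ψ O :=
  ⟨fun ⟨p, hQ⟩ ↦ ⟨p.N, p.M, p.a, p.T, p.δ, p.V, p.C₁, p.C₂, p.ρ₀, p.κ, p.ξ, p.β, p.U₀, p.B₀, p.B,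
    p.Ψ₀, p.Ψ, p.O, p.isFinalEra₂, hQ⟩,
    fun ⟨_, _, _, _, _, _, _, _, _, _, _, _, _, _, _, _, _, _, h, hQ⟩ ↦ ⟨ofIsFinalEra₂ h, hQ⟩⟩

/-! ### Forgetting to the rev-1 package -/

/-- The data of a rev-2 package satisfy the rev-1 inline form `CauchyDevelopment.IsFinalEra`
((H2′) at `m = 0` gives (H2); (AT), (ND) dropped — `IsFinalEra₂.isFinalEra`). Dafermos–Luk,
arXiv:1710.01722, p. 8 (the picture; no printed formulation). [cite: DafermosLuk2017, p. 8] -/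
theorem isFinalEra (p : FinalEraPackage₂ 𝒟) :
    𝒟.IsFinalEra p.N p.M p.a p.T p.δ p.V p.C₁ p.C₂ p.ρ₀ p.κ p.ξ p.β p.U₀ p.B₀ p.B p.Ψ₀ p.Ψ p.O :=
  p.isFinalEra₂.isFinalEra

/-- **The forgetful map to the rev-1 package**: a rev-2 final-era package is in particular a
rev-1 final-era package with the SAME data (all 18 data projections agree by `rfl`,
`toFinalEraPackage_ξ` etc.), the rev-1 clause (H2) being derived from (H2′) at `m = 0` and the
clauses (AT), (ND) forgotten; everything proved about `FinalEraPackage` thus applies to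
`FinalEraPackage₂`. Dafermos–Luk, arXiv:1710.01722, p. 8 (the picture; no printed
formulation). [cite: DafermosLuk2017, p. 8] -/
def toFinalEraPackage (p : FinalEraPackage₂ 𝒟) : FinalEraPackage 𝒟 :=
  FinalEraPackage.ofIsFinalEra p.isFinalEra

/-- `toFinalEraPackage` keeps `N`. [folklore] -/
@[simp] theorem toFinalEraPackage_N (p : FinalEraPackage₂ 𝒟) : p.toFinalEraPackage.N = p.N := rfl

/-- `toFinalEraPackage` keeps the masses `M`. [folklore] -/
@[simp] theorem toFinalEraPackage_M (p : FinalEraPackage₂ 𝒟) : p.toFinalEraPackage.M = p.M := rfl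

/-- `toFinalEraPackage` keeps the spins `a`. [folklore] -/
@[simp] theorem toFinalEraPackage_a (p : FinalEraPackage₂ 𝒟) : p.toFinalEraPackage.a = p.a := rfl

/-- `toFinalEraPackage` keeps the late time `T`. [folklore] -/
@[simp] theorem toFinalEraPackage_T (p : FinalEraPackage₂ 𝒟) : p.toFinalEraPackage.T = p.T := rfl

/-- `toFinalEraPackage` keeps the separation floor `δ`. [folklore] -/
@[simp] theorem toFinalEraPackage_δ (p : FinalEraPackage₂ 𝒟) : p.toFinalEraPackage.δ = p.δ := rfl

/-- `toFinalEraPackage` keeps the speed bound `V`. [folklore] -/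
@[simp] theorem toFinalEraPackage_V (p : FinalEraPackage₂ 𝒟) : p.toFinalEraPackage.V = p.V := rfl

/-- `toFinalEraPackage` keeps `C₁`. [folklore] -/
@[simp] theorem toFinalEraPackage_C₁ (p : FinalEraPackage₂ 𝒟) : p.toFinalEraPackage.C₁ = p.C₁ :=
  rfl

/-- `toFinalEraPackage` keeps `C₂`. [folklore] -/
@[simp] theorem toFinalEraPackage_C₂ (p : FinalEraPackage₂ 𝒟) : p.toFinalEraPackage.C₂ = p.C₂ :=
  rfl

/-- `toFinalEraPackage` keeps the near-zone radius `ρ₀`. [folklore] -/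
@[simp] theorem toFinalEraPackage_ρ₀ (p : FinalEraPackage₂ 𝒟) : p.toFinalEraPackage.ρ₀ = p.ρ₀ :=
  rfl

/-- `toFinalEraPackage` keeps the slack constant `κ`. [folklore] -/
@[simp] theorem toFinalEraPackage_κ (p : FinalEraPackage₂ 𝒟) : p.toFinalEraPackage.κ = p.κ := rfl

/-- `toFinalEraPackage` keeps the worldlines `ξ`. [folklore] -/
@[simp] theorem toFinalEraPackage_ξ (p : FinalEraPackage₂ 𝒟) : p.toFinalEraPackage.ξ = p.ξ := rfl

/-- `toFinalEraPackage` keeps the slack function `β`. [folklore] -/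
@[simp] theorem toFinalEraPackage_β (p : FinalEraPackage₂ 𝒟) : p.toFinalEraPackage.β = p.β := rfl

/-- `toFinalEraPackage` keeps the flat domain `U₀`. [folklore] -/
@[simp] theorem toFinalEraPackage_U₀ (p : FinalEraPackage₂ 𝒟) : p.toFinalEraPackage.U₀ = p.U₀ :=
  rfl

/-- `toFinalEraPackage` keeps the flat background `B₀`. [folklore] -/
@[simp] theorem toFinalEraPackage_B₀ (p : FinalEraPackage₂ 𝒟) : p.toFinalEraPackage.B₀ = p.B₀ :=
  rfl

/-- `toFinalEraPackage` keeps the hole backgrounds `B`. [folklore] -/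
@[simp] theorem toFinalEraPackage_B (p : FinalEraPackage₂ 𝒟) : p.toFinalEraPackage.B = p.B := rfl

/-- `toFinalEraPackage` keeps the flat chart `Ψ₀`. [folklore] -/
@[simp] theorem toFinalEraPackage_Ψ₀ (p : FinalEraPackage₂ 𝒟) : p.toFinalEraPackage.Ψ₀ = p.Ψ₀ :=
  rfl

/-- `toFinalEraPackage` keeps the hole charts `Ψ`. [folklore] -/
@[simp] theorem toFinalEraPackage_Ψ (p : FinalEraPackage₂ 𝒟) : p.toFinalEraPackage.Ψ = p.Ψ := rfl

/-- `toFinalEraPackage` keeps the region `O`. [folklore] -/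
@[simp] theorem toFinalEraPackage_O (p : FinalEraPackage₂ 𝒟) : p.toFinalEraPackage.O = p.O := rfl

/-- A rev-1 package that comes from a rev-2 package re-packages, via its own inline form, to
itself (round trip through `FinalEraPackage.ofIsFinalEra`, `rfl`). [folklore] -/
theorem toFinalEraPackage_eq_ofIsFinalEra (p : FinalEraPackage₂ 𝒟) :
    p.toFinalEraPackage = FinalEraPackage.ofIsFinalEra p.isFinalEra := rfl

/-- **(H2) of rev 1, derived**: `C⁰` closeness `≤ 1/100` of every near zone `{rᵢ ≤ 2ρ₀}` to its
Kerr label on the hole slabs `{t*ᵢ = τ}`, `τ ≥ T` — the `m = 0` case of the scale-covariant pin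
(H2′) (`IsFinalEra₂.isFinalEra`). Dafermos–Luk, arXiv:1710.01722, p. 8 (the picture; no printed
formulation). [cite: DafermosLuk2017, p. 8] -/
theorem truncDeviationCk_le (p : FinalEraPackage₂ 𝒟) (i : Fin p.N) (τ : ℝ) (hτ : p.T ≤ τ) :
    𝒟.toSpacetime.truncDeviationCk (p.B i) (p.Ψ i) 0 (2 * p.ρ₀) τ ≤ ENNReal.ofReal (1 / 100) :=
  p.toFinalEraPackage.truncDeviationCk_le i τ hτ

/-- (H2′) at `m = 0` pointwise: `‖(Ψᵢ^* g − g_{Mᵢ,aᵢ})(x)‖ ≤ 1/100` at every point of the hole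
chart domain with `x⁰ ≥ T` and `rᵢ ≤ 2ρ₀` (`D⁰F(x)` has the norm of `F(x)`). [folklore] -/
theorem norm_deviationExtend_le (p : FinalEraPackage₂ 𝒟) (i : Fin p.N) (x : (p.B i).domain)
    (hT : p.T ≤ x.1 0) (hr : (p.B i).radius x.1 ≤ 2 * p.ρ₀) :
    ‖𝒟.toSpacetime.deviationExtend (p.B i) (p.Ψ i) x.1‖ ≤ 1 / 100 := by
  have h := p.norm_iteratedFDeriv_le i 0 x (Nat.zero_le 2) hT hr
  rwa [norm_iteratedFDeriv_zero, pow_zero, mul_one] at h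

/-- Sanity API (AT, unfolded): the certified tubes of two distinct labels are disjoint.
[folklore] -/
theorem disjoint_image_truncLateRegion (p : FinalEraPackage₂ 𝒟) {i j : Fin p.N} (hij : i ≠ j) :
    Disjoint (p.Ψ i '' (p.B i).truncLateRegion p.T (2 * p.ρ₀))
      (p.Ψ j '' (p.B j).truncLateRegion p.T (2 * p.ρ₀)) :=
  p.pairwise_disjoint hij

/-- Sanity API (ND with (P)): the certified-zone radius `2ρ₀` exceeds the horizon diameter
scale, `2 r₊(Mᵢ, aᵢ) < 2ρ₀`. [folklore] -/
theorem two_mul_rPlus_lt (p : FinalEraPackage₂ 𝒟) (i : Fin p.N) :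
    2 * Kerr.rPlus (p.M i) (p.a i) < 2 * p.ρ₀ :=
  mul_lt_mul_of_pos_left (p.rPlus_lt i) two_pos

/-- Sanity API (ND): the masses of a rev-2 package are below the near-zone radius,
`Mᵢ ≤ Mᵢ + √(Mᵢ² − aᵢ²) = r₊(Mᵢ, aᵢ) < ρ₀`. [folklore] -/
theorem M_lt_ρ₀ (p : FinalEraPackage₂ 𝒟) (i : Fin p.N) : p.M i < p.ρ₀ := by
  have h := p.rPlus_lt i
  unfold Kerr.rPlus at h
  linarith [Real.sqrt_nonneg (p.M i ^ 2 - p.a i ^ 2)]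

end FinalEraPackage₂

end Literature.Geometry.Lorentzian

end
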